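import Literature.Geometry.Riemannian.LocalIsometryTransport
import Literature.Geometry.Riemannian.ClopenSubmanifoldMetric
import Literature.Geometry.Lorentzian.LeviCivitaProofs
import HarnessLib

/-!
# Locality of the Riemann curvature tensor

Topic `Geometry/Riemannian`. Two `C^∞` metrics on `M` which agree on an open set `O` have the
same covariant curvature tensor `Rm` at the points of `O` (`curvatureForm_eq_of_val_eq_on_opens`):
both restrict to the same pullback metric on the open submanifold `O`
(`PseudoRiemannianMetric.comap` along the inclusion, whose differential is the identity), and `Rm`
is natural under equidimensional immersions (`curvatureForm_eq_of_val_eq`, O'Neill 1983, Ch. 3,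
Prop. 3.59). Used to see that Weinstein's modified metric `g₁ = g₀` (off the disk) has the
curvature of `g₀` there (hypothesis `hsec` of the criterion; Weinstein 1968, proof of the main
theorem).

## References

* B. O'Neill, *Semi-Riemannian Geometry* (1983), Ch. 3, Prop. 3.59. [cite: ONeill1983, Ch. 3, Prop. 3.59]
* A. Weinstein, Ann. of Math. (2) 87 (1968), 29–41. [cite: Weinstein1968]

Tags: [Curvature] [Weinstein1968]
-/

noncomputable section

open Bundle Set Function Filter TopologicalSpace
open scoped Manifold ContDiff Topology

namespace Literature.Geometry.Riemannian

open Literature.Geometry.Lorentzian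
open Literature.Geometry.Lorentzian.PseudoRiemannianMetric
open Literature.Geometry.Manifold

variable {E : Type*} [NormedAddCommGroup E] [NormedSpace ℝ E] [FiniteDimensional ℝ E]
  [CompleteSpace E] {H : Type*} [TopologicalSpace H] {I : ModelWithCorners ℝ E H}
  {M : Type*} [TopologicalSpace M] [ChartedSpace H M] [IsManifold I ∞ M]
  (g₁ g₂ : PseudoRiemannianMetric I ∞ E (TangentSpace I : M → Type _))
  [g₁.HasLeviCivita] [g₂.HasLeviCivita]

/-- **Locality of `Rm`.** If `g₁ = g₂` on the open set `O`, then `Rm^{g₁} = Rm^{g₂}` at the points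
of `O`. [cite: ONeill1983, Ch. 3, Prop. 3.59] -/
theorem curvatureForm_eq_of_val_eq_on_opens (O : Opens M) (h : ∀ x : O, g₁.val x = g₂.val x)
    (x : O) (X Y Z W : TangentSpace I (x : M)) :
    g₁.curvatureForm g₁.leviCivita x X Y Z W = g₂.curvatureForm g₂.leviCivita x X Y Z W := by
  have hpb : contMDiff_pullbackBilin I M I O ∞ := contMDiff_pullbackBilin_holds
  have hΦ : ContMDiff I I ((∞ : ℕ∞ω) + 1) (Subtype.val : O → M) := contMDiff_subtype_val
  have hΦ' : ∀ u : O, Injective (mfderiv I I (Subtype.val : O → M) u) :=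
    injective_mfderiv_subtype_val O
  set gN := g₁.comap hpb Subtype.val hΦ hΦ' rfl with hgN
  haveI : gN.HasLeviCivita := gN.hasLeviCivita
  have hd : ∀ (u : O) (v : TangentSpace I u), mfderiv I I (Subtype.val : O → M) u v = v := by
    intro u v; rw [OpenSubmanifold.mfderiv_subtype_val]; rfl
  have hval₁ : ∀ (u : O) (v w : TangentSpace I u),
      gN.val u v w = g₁.val (u : M) (mfderiv I I (Subtype.val : O → M) u v)
        (mfderiv I I (Subtype.val : O → M) u w) := by
    intro u v w; rw [hgN, val_comap, pullbackBilin_apply]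
  have hval₂ : ∀ (u : O) (v w : TangentSpace I u),
      gN.val u v w = g₂.val (u : M) (mfderiv I I (Subtype.val : O → M) u v)
        (mfderiv I I (Subtype.val : O → M) u w) := by
    intro u v w; rw [hval₁, h u]
  have h1 := curvatureForm_eq_of_val_eq g₁ hΦ hΦ' rfl gN hval₁ x X Y Z W
  have h2 := curvatureForm_eq_of_val_eq g₂ hΦ hΦ' rfl gN hval₂ x X Y Z W
  simp only [hd] at h1 h2
  rw [← h1, ← h2]

/-- **Locality of `Rm`, pointwise form**: if `g₁ = g₂` on a neighbourhood of `x`, then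
`Rm^{g₁}_x = Rm^{g₂}_x`. [cite: ONeill1983, Ch. 3, Prop. 3.59] -/
theorem curvatureForm_eq_of_eventuallyEq {x : M} (h : ∀ᶠ y in 𝓝 x, g₁.val y = g₂.val y)
    (X Y Z W : TangentSpace I x) :
    g₁.curvatureForm g₁.leviCivita x X Y Z W = g₂.curvatureForm g₂.leviCivita x X Y Z W := by
  obtain ⟨O, hO, hOo, hxO⟩ := mem_nhds_iff.1 h
  exact curvatureForm_eq_of_val_eq_on_opens g₁ g₂ ⟨O, hOo⟩ (fun y ↦ hO y.2) ⟨x, hxO⟩ X Y Z W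

end Literature.Geometry.Riemannian

end
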